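import Literature.NumberTheory.Sieve.SelbergSieveCoupling
import Literature.NumberTheory.Sieve.SelbergSieveOneDim
import HarnessLib

/-!
# The `(k+1)`-dimensional box of Maynard's Proposition 9.4: product weights and the coupling sum

Source: J. Maynard, *Dense clusters of primes in subsets*, Compositio Math. 152 (2016) =
arXiv:1405.2593 [Maynard2016DenseClusters], proof of Proposition 9.4 pp. 25–26. For a form
`L = L_{k+1} ∉ 𝓛` the weights of the upper bound are PRODUCTS `λ⁺_{d⁺} = λ_d · λ̃_{d₀}`
(`d⁺ = (d, d₀)`, `λ̃` the one-dimensional weights with `ỹ ≡ 1` of `SelbergSieveOneDim`) on the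
`(k+1)`-dimensional box, whose square-free condition couples the two factors through `(∏ d, d₀) = 1`.
After the change of variables `y⁺ = dualY λ⁺` (`SelbergSieveGBox`) one must control `y⁺`; inserting
the definitions of `λ` and `λ̃` gives (P94-SPEC §1d′)
`y⁺_{(r,r₀)} = μ(∏ r · r₀) ∑_{g ⊇ r} ∑_{g₀ ⊇ r₀} Y_g φ(g₀)^{-1} · B(r; g, g₀)`,
`B := ∑_{r ∣ f ∣ g} ∑_{r₀ ∣ f₀ ∣ g₀} [(∏ f, f₀) = 1] μ(∏ f) μ(f₀)` — the COUPLING SUM.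

This file sets up the extended box generically (index type `Option κ`, the extra coordinate `none`
of real level `R₀` and modulus `M`) and proves that identity:
* `optN`, `optW`, **`mem_gBox_opt`** — `d⁺ ∈ box⁺ ↔ d ∈ box ∧ d₀ ∈ box₀ M R₀ ∧ (∏ d, d₀) = 1`;
* `lamProd` (`λ⁺ = lamOfY Y · lamT`), `couplingB`;
* **`dualY_lamProd_eq`** — the displayed identity; `couplingB_eq_zero_of_not_dvd`;
* **`couplingB_eq_zero_left`** / **`couplingB_eq_zero_right`** — `B = 0` as soon as a prime of `g`
  outside `r` does not divide `g₀` (resp. a prime of `g₀` outside `r₀` does not divide `∏ g`):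
  `SelbergSieveCoupling.sum_interval_moebius_mul_eq_zero` / `sum_divisors_interval_moebius_mul_eq_zero`
  applied to the inner sums (the coprimality weight is toggle-invariant);
* `abs_couplingB_le` — the trivial bound `|B| ≤ #{f} · #{f₀}`.

## References
* J. Maynard, *Dense clusters of primes in subsets*, Compositio Math. 152 (2016), proof of Prop. 9.4
  pp. 25–26 [Maynard2016DenseClusters].
-/

noncomputable section

open Finset
open scoped ArithmeticFunction.Moebius

namespace Literature.NumberTheory.Sieve.SelbergBox

variable {κ : Type*} [Fintype κ] [DecidableEq κ]

/-! ### The extended box on `Option κ` -/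

/-- Levels of the extended box: `N_j` on the old coordinates, `⌊R₀⌋` on the new one.
[cite: Maynard2016DenseClusters, proof of Prop. 9.4 p. 25 («r₀ ≤ N^ξ»)] -/
def optN (N₁ : κ → ℕ) (R₀ : ℝ) : Option κ → ℕ := fun o => o.elim ⌊R₀⌋₊ N₁

/-- Moduli of the extended box: `W_j` on the old coordinates, `M` (`= W_{k+1}`) on the new one.
[cite: Maynard2016DenseClusters, proof of Prop. 9.4 p. 25 («(d_{k+1}, W_{k+1}) = 1»)] -/
def optW (W₁ : κ → ℕ) (M : ℕ) : Option κ → ℕ := fun o => o.elim M W₁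

omit [Fintype κ] [DecidableEq κ] in
/-- Level of the new coordinate: `⌊R₀⌋`. [cite: Maynard2016DenseClusters, proof of Prop. 9.4 p. 25 («r₀ ≤ N^ξ»)] -/
@[simp] theorem optN_none (N₁ : κ → ℕ) (R₀ : ℝ) : optN N₁ R₀ none = ⌊R₀⌋₊ := rfl
omit [Fintype κ] [DecidableEq κ] in
/-- Levels of the old coordinates: `N_i`. [cite: Maynard2016DenseClusters, proof of Prop. 9.4 p. 25] -/
@[simp] theorem optN_some (N₁ : κ → ℕ) (R₀ : ℝ) (i : κ) : optN N₁ R₀ (some i) = N₁ i := rfl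
omit [Fintype κ] [DecidableEq κ] in
/-- Modulus of the new coordinate: `M = W_{k+1}`. [cite: Maynard2016DenseClusters, proof of Prop. 9.4 p. 25 («(d_{k+1}, W_{k+1}) = 1»)] -/
@[simp] theorem optW_none (W₁ : κ → ℕ) (M : ℕ) : optW W₁ M none = M := rfl
omit [Fintype κ] [DecidableEq κ] in
/-- Moduli of the old coordinates: `W_i`. [cite: Maynard2016DenseClusters, proof of Prop. 9.4 p. 25] -/
@[simp] theorem optW_some (W₁ : κ → ℕ) (M : ℕ) (i : κ) : optW W₁ M (some i) = W₁ i := rfl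

/-- **Membership in the extended box**: `d⁺ ∈ box⁺ ↔ (d⁺ ∘ some) ∈ box ∧ d⁺(none) ∈ box₀ M R₀ ∧
(∏ᵢ d⁺(some i), d⁺(none)) = 1` — the square-free condition on the full product is exactly the
coupling `(∏ d, d₀) = 1`.
[cite: Maynard2016DenseClusters, proof of Prop. 9.4 p. 25 ((k+1)-dimensional square-free vectors)] -/
theorem mem_gBox_opt {N₁ W₁ : κ → ℕ} {M : ℕ} {R₀ : ℝ} {d : Option κ → ℕ} :
    d ∈ gBox (optN N₁ R₀) (optW W₁ M) ↔
      (fun i => d (some i)) ∈ gBox N₁ W₁ ∧ d none ∈ box₀ M R₀ ∧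
        (∏ i, d (some i)).Coprime (d none) := by
  rw [mem_gBox, mem_gBox, mem_box₀, Fintype.prod_option, Nat.squarefree_mul_iff, Option.forall,
    Option.forall]
  simp only [optN_none, optN_some, optW_none, optW_some]
  constructor
  · rintro ⟨⟨h0N, hN⟩, ⟨hcop, hsq0, hsq⟩, h0W, hW⟩
    exact ⟨⟨hN, hsq, hW⟩, ⟨h0N, hsq0, h0W⟩, Nat.coprime_comm.1 hcop⟩
  · rintro ⟨⟨hN, hsq, hW⟩, ⟨h0N, hsq0, h0W⟩, hcop⟩
    exact ⟨⟨h0N, hN⟩, ⟨Nat.coprime_comm.1 hcop, hsq0, hsq⟩, h0W, hW⟩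

/-! ### Product weights and the coupling sum -/

/-- The product weights `λ⁺_{d⁺} = λ_d · λ̃_{d₀}` with `λ = lamOfY Y` (`k`-dimensional, (8.6)) and
`λ̃ = lamT M R₀` (one-dimensional, `ỹ ≡ 1`).
[cite: Maynard2016DenseClusters, proof of Prop. 9.4 p. 25 («y_{r,r₀} = y_r»)] -/
def lamProd (N₁ W₁ : κ → ℕ) (Y : (κ → ℕ) → ℝ) (M : ℕ) (R₀ : ℝ) (d : Option κ → ℕ) : ℝ :=
  lamOfY N₁ W₁ Y (fun i => d (some i)) * lamT M R₀ (d none)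

/-- The COUPLING SUM `B(r⁺; g, g₀) = ∑_{f ∈ box, r ∣ f ∣ g} ∑_{f₀ ∣ g₀, r₀ ∣ f₀} [(∏ f, f₀) = 1] μ(∏ f) μ(f₀)`.
[cite: Maynard2016DenseClusters, proof of Prop. 9.4 p. 25 (change of variables on the (k+1)-dimensional box)] -/
def couplingB (N₁ W₁ : κ → ℕ) (r : Option κ → ℕ) (g : κ → ℕ) (g₀ : ℕ) : ℝ :=
  ∑ f ∈ (gBox N₁ W₁).filter (fun f => (∀ i, r (some i) ∣ f i) ∧ ∀ i, f i ∣ g i),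
    ∑ f₀ ∈ g₀.divisors.filter (fun f₀ => r none ∣ f₀),
      if (∏ i, f i).Coprime f₀ then ((μ (∏ i, f i) : ℤ) : ℝ) * ((μ f₀ : ℤ) : ℝ) else 0

/-- **The dual variables of the product weights** (P94-SPEC §1d′):
`dualY λ⁺ (r⁺) = μ(∏ r⁺) ∑_{g ∈ box} ∑_{g₀ ∈ box₀} Y_g φ(g₀)^{-1} B(r⁺; g, g₀)`.
(The `g`, `g₀` with `r ∤ g` resp. `r₀ ∤ g₀` contribute `B = 0`, empty sums.)
[cite: Maynard2016DenseClusters, proof of Prop. 9.4 pp. 25–26 (substituting λ and λ̃ into y⁺)] -/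
theorem dualY_lamProd_eq (N₁ W₁ : κ → ℕ) (Y : (κ → ℕ) → ℝ) (M : ℕ) (R₀ : ℝ) (r : Option κ → ℕ) :
    dualY (optN N₁ R₀) (optW W₁ M) (lamProd N₁ W₁ Y M R₀) r =
      ((μ (∏ o, r o) : ℤ) : ℝ) * ∑ g ∈ gBox N₁ W₁, ∑ g₀ ∈ box₀ M R₀,
        Y g * ((Nat.totient g₀ : ℕ) : ℝ)⁻¹ * couplingB N₁ W₁ r g g₀ := by
  classical
  set box := gBox N₁ W₁ with hbox
  set bx0 := box₀ M R₀ with hbx0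
  set boxP := gBox (optN N₁ R₀) (optW W₁ M) with hboxP
  unfold dualY
  congr 1
  -- Step 1: simplify each term `λ⁺_f / ∏ f`.
  have hterm : ∀ f ∈ boxP.filter (fun f => ∀ o, r o ∣ f o),
      lamProd N₁ W₁ Y M R₀ f / ∏ o, (f o : ℝ) =
        ((μ (∏ i, f (some i)) : ℤ) : ℝ) * ((μ (f none) : ℤ) : ℝ) *
          ((∑ g ∈ box.filter (fun g => ∀ i, f (some i) ∣ g i), Y g) *
            ∑ g₀ ∈ bx0.filter (fun g₀ => f none ∣ g₀), ((Nat.totient g₀ : ℕ) : ℝ)⁻¹) := by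
    intro f hf
    obtain ⟨hfP, -⟩ := Finset.mem_filter.1 hf
    have hf1 : ∀ o, 1 ≤ f o := one_le_of_mem_gBox hfP
    have hP0 : (∏ i, (f (some i) : ℝ)) ≠ 0 :=
      Finset.prod_ne_zero_iff.2 fun i _ => by
        have := hf1 (some i); exact_mod_cast (by omega : f (some i) ≠ 0)
    have hn0 : (f none : ℝ) ≠ 0 := by
      have := hf1 none; exact_mod_cast (by omega : f none ≠ 0)
    have hprod : ∏ o, (f o : ℝ) = (f none : ℝ) * ∏ i, (f (some i) : ℝ) :=
      Fintype.prod_option fun o => (f o : ℝ)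
    rw [hprod, div_eq_iff (mul_ne_zero hn0 hP0)]
    unfold lamProd lamOfY lamT
    ring
  rw [Finset.sum_congr rfl hterm]
  -- Step 2: expand the product of the two sums and move the `(g, g₀)` sums outside.
  have hexp : ∀ f ∈ boxP.filter (fun f => ∀ o, r o ∣ f o),
      ((μ (∏ i, f (some i)) : ℤ) : ℝ) * ((μ (f none) : ℤ) : ℝ) *
          ((∑ g ∈ box.filter (fun g => ∀ i, f (some i) ∣ g i), Y g) *
            ∑ g₀ ∈ bx0.filter (fun g₀ => f none ∣ g₀), ((Nat.totient g₀ : ℕ) : ℝ)⁻¹) =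
        ∑ g ∈ box, ∑ g₀ ∈ bx0,
          if (∀ i, f (some i) ∣ g i) ∧ f none ∣ g₀ then
            Y g * ((Nat.totient g₀ : ℕ) : ℝ)⁻¹ *
              (((μ (∏ i, f (some i)) : ℤ) : ℝ) * ((μ (f none) : ℤ) : ℝ)) else 0 := by
    intro f _
    rw [Finset.sum_filter, Finset.sum_filter, Finset.sum_mul_sum, Finset.mul_sum]
    refine Finset.sum_congr rfl fun g _ => ?_
    rw [Finset.mul_sum]
    refine Finset.sum_congr rfl fun g₀ _ => ?_
    by_cases h1 : ∀ i, f (some i) ∣ g i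
    · by_cases h2 : f none ∣ g₀
      · rw [if_pos h1, if_pos h2,
          if_pos (show (∀ i, f (some i) ∣ g i) ∧ f none ∣ g₀ from ⟨h1, h2⟩)]
        ring
      · rw [if_pos h1, if_neg h2,
          if_neg (show ¬ ((∀ i, f (some i) ∣ g i) ∧ f none ∣ g₀) from fun h => h2 h.2)]
        ring
    · rw [if_neg h1, if_neg (show ¬ ((∀ i, f (some i) ∣ g i) ∧ f none ∣ g₀) from fun h => h1 h.1)]
      ring
  rw [Finset.sum_congr rfl hexp, Finset.sum_comm]
  refine Finset.sum_congr rfl fun g hg => ?_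
  rw [Finset.sum_comm]
  refine Finset.sum_congr rfl fun g₀ hg₀ => ?_
  -- Step 3: the inner `f`-sum is `Y g φ(g₀)⁻¹ B(r; g, g₀)`.
  rw [← Finset.sum_filter, Finset.filter_filter]
  have hinner : ∑ f ∈ boxP.filter (fun f => (∀ o, r o ∣ f o) ∧ (∀ i, f (some i) ∣ g i) ∧ f none ∣ g₀),
      Y g * ((Nat.totient g₀ : ℕ) : ℝ)⁻¹ *
        (((μ (∏ i, f (some i)) : ℤ) : ℝ) * ((μ (f none) : ℤ) : ℝ)) =
      Y g * ((Nat.totient g₀ : ℕ) : ℝ)⁻¹ *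
        ∑ f ∈ boxP.filter (fun f => (∀ o, r o ∣ f o) ∧ (∀ i, f (some i) ∣ g i) ∧ f none ∣ g₀),
          ((μ (∏ i, f (some i)) : ℤ) : ℝ) * ((μ (f none) : ℤ) : ℝ) := by
    rw [Finset.mul_sum]
  rw [hinner]
  congr 1
  -- the bijection `f ↦ (f ∘ some, f none)` onto the coprime pairs
  have hg' : ∀ i, 1 ≤ g i := one_le_of_mem_gBox hg
  have hg₀' := mem_box₀.1 hg₀
  have hg₀0 : g₀ ≠ 0 := Nat.one_le_iff_ne_zero.1 hg₀'.1.1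
  unfold couplingB
  rw [← Finset.sum_product', ← Finset.sum_filter]
  symm
  refine Finset.sum_nbij' (fun q : (κ → ℕ) × ℕ => fun o : Option κ => o.elim q.2 q.1)
    (fun f => (fun i => f (some i), f none)) ?_ ?_ ?_ ?_ ?_
  · -- pairs ↦ box⁺
    rintro ⟨f₁, f₀⟩ hq
    obtain ⟨hq1, hcop⟩ := Finset.mem_filter.1 hq
    obtain ⟨hf₁, hf₀⟩ := Finset.mem_product.1 hq1
    obtain ⟨hf₁box, hrf₁, hf₁g⟩ := Finset.mem_filter.1 hf₁
    obtain ⟨hf₀d, hrf₀⟩ := Finset.mem_filter.1 hf₀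
    have hf₀g : f₀ ∣ g₀ := (Nat.mem_divisors.1 hf₀d).1
    refine Finset.mem_filter.2 ⟨?_, ?_, ?_, ?_⟩
    · refine mem_gBox_opt.2 ⟨?_, ?_, ?_⟩
      · exact hf₁box
      · exact mem_box₀_of_dvd hg₀ hf₀g
      · exact hcop
    · intro o
      cases o with
      | none => exact hrf₀
      | some i => exact hrf₁ i
    · exact hf₁g
    · exact hf₀g
  · -- box⁺ ↦ pairs
    intro f hf
    obtain ⟨hfP, hrf, hfg, hf₀g⟩ := Finset.mem_filter.1 hf
    obtain ⟨hf₁box, hf₀box, hcop⟩ := mem_gBox_opt.1 hfP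
    refine Finset.mem_filter.2 ⟨Finset.mem_product.2 ⟨?_, ?_⟩, hcop⟩
    · exact Finset.mem_filter.2 ⟨hf₁box, fun i => hrf (some i), hfg⟩
    · exact Finset.mem_filter.2 ⟨Nat.mem_divisors.2 ⟨hf₀g, hg₀0⟩, hrf none⟩
  · rintro ⟨f₁, f₀⟩ _
    rfl
  · intro f _
    funext o
    cases o <;> rfl
  · rintro ⟨f₁, f₀⟩ _
    rfl

/-- The same with the `g`, `g₀` sums restricted to the multiples of `r`, `r₀` (the other terms have
empty coupling sums). [cite: Maynard2016DenseClusters, proof of Prop. 9.4 pp. 25–26] -/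
theorem couplingB_eq_zero_of_not_dvd (N₁ W₁ : κ → ℕ) (r : Option κ → ℕ) (g : κ → ℕ) (g₀ : ℕ)
    (h : ¬ ((∀ i, r (some i) ∣ g i) ∧ r none ∣ g₀)) : couplingB N₁ W₁ r g g₀ = 0 := by
  unfold couplingB
  by_cases h1 : ∀ i, r (some i) ∣ g i
  · have h2 : ¬ r none ∣ g₀ := fun h2 => h ⟨h1, h2⟩
    refine Finset.sum_eq_zero fun f _ => Finset.sum_eq_zero fun f₀ hf₀ => ?_
    obtain ⟨hf₀d, hrf₀⟩ := Finset.mem_filter.1 hf₀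
    exact absurd (hrf₀.trans (Nat.mem_divisors.1 hf₀d).1) h2
  · refine Finset.sum_eq_zero fun f hf => ?_
    obtain ⟨-, hrf, hfg⟩ := Finset.mem_filter.1 hf
    exact absurd (fun i => (hrf i).trans (hfg i)) h1

/-! ### Vanishing and size of the coupling sum -/

/-- **`B = 0` (first kind)**: if a prime `p ∣ g_j` has `p ∤ r_j` and `p ∤ g₀`, then `B(r⁺; g, g₀) = 0`
(toggle `p` in the `j`-th coordinate of `f`; the weight `[(∏ f, f₀) = 1] μ(f₀)` is invariant since `p ∤ f₀`).
[cite: Maynard2016DenseClusters, proof of Prop. 9.4 pp. 25–26] -/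
theorem couplingB_eq_zero_left {N₁ W₁ : κ → ℕ} {r : Option κ → ℕ} {g : κ → ℕ} {g₀ : ℕ}
    (hg : g ∈ gBox N₁ W₁) {p : ℕ} (hp : p.Prime) {j : κ} (hpg : p ∣ g j) (hpr : ¬ p ∣ r (some j))
    (hpg₀ : ¬ p ∣ g₀) : couplingB N₁ W₁ r g g₀ = 0 := by
  unfold couplingB
  rw [Finset.sum_comm]
  refine Finset.sum_eq_zero fun f₀ hf₀ => ?_
  obtain ⟨hf₀d, -⟩ := Finset.mem_filter.1 hf₀
  have hpf₀ : ¬ p ∣ f₀ := fun h => hpg₀ (h.trans (Nat.mem_divisors.1 hf₀d).1)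
  have hrw : ∀ f ∈ (gBox N₁ W₁).filter (fun f => (∀ i, r (some i) ∣ f i) ∧ ∀ i, f i ∣ g i),
      (if (∏ i, f i).Coprime f₀ then ((μ (∏ i, f i) : ℤ) : ℝ) * ((μ f₀ : ℤ) : ℝ) else 0) =
        ((μ (∏ i, f i) : ℤ) : ℝ) * (if (∏ i, f i).Coprime f₀ then ((μ f₀ : ℤ) : ℝ) else 0) := by
    intro f _
    split_ifs <;> ring
  rw [Finset.sum_congr rfl hrw]
  refine sum_interval_moebius_mul_eq_zero (r := fun i => r (some i)) hg hp hpg hpr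
    (fun f => if (∏ i, f i).Coprime f₀ then ((μ f₀ : ℤ) : ℝ) else 0) fun f _ _ => ?_
  exact if_congr (coprime_prod_update_iff hp hpf₀) rfl rfl

/-- **`B = 0` (second kind)**: if `g₀` is square-free and a prime `p ∣ g₀` has `p ∤ r₀` and
`p ∤ ∏ g`, then `B(r⁺; g, g₀) = 0` (toggle `p` in `f₀`).
[cite: Maynard2016DenseClusters, proof of Prop. 9.4 pp. 25–26] -/
theorem couplingB_eq_zero_right {N₁ W₁ : κ → ℕ} {r : Option κ → ℕ} {g : κ → ℕ} {g₀ : ℕ}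
    (hg₀ : Squarefree g₀) {p : ℕ} (hp : p.Prime) (hpg₀ : p ∣ g₀) (hpr : ¬ p ∣ r none)
    (hpg : ¬ p ∣ ∏ i, g i) : couplingB N₁ W₁ r g g₀ = 0 := by
  unfold couplingB
  refine Finset.sum_eq_zero fun f hf => ?_
  obtain ⟨-, -, hfg⟩ := Finset.mem_filter.1 hf
  have hpf : ¬ p ∣ ∏ i, f i := fun h =>
    hpg (h.trans (Finset.prod_dvd_prod_of_dvd _ _ fun i _ => hfg i))
  have hrw : ∀ f₀ ∈ g₀.divisors.filter (fun f₀ => r none ∣ f₀),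
      (if (∏ i, f i).Coprime f₀ then ((μ (∏ i, f i) : ℤ) : ℝ) * ((μ f₀ : ℤ) : ℝ) else 0) =
        ((μ f₀ : ℤ) : ℝ) * (if (∏ i, f i).Coprime f₀ then ((μ (∏ i, f i) : ℤ) : ℝ) else 0) := by
    intro f₀ _
    split_ifs <;> ring
  rw [Finset.sum_congr rfl hrw]
  refine sum_divisors_interval_moebius_mul_eq_zero hg₀ hp hpg₀ hpr
    (fun f₀ => if (∏ i, f i).Coprime f₀ then ((μ (∏ i, f i) : ℤ) : ℝ) else 0) fun f₀ _ _ => ?_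
  have h := coprime_toggle_iff (f := f₀) (n := ∏ i, f i) hp hpf
  have h' : (∏ i, f i).Coprime (if p ∣ f₀ then f₀ / p else f₀ * p) ↔ (∏ i, f i).Coprime f₀ := by
    rw [Nat.coprime_comm, h, Nat.coprime_comm]
  exact if_congr h' rfl rfl

/-- The trivial bound `|B(r⁺; g, g₀)| ≤ #{f ∈ box : r ∣ f ∣ g} · #{f₀ ∣ g₀ : r₀ ∣ f₀}`.
[cite: Maynard2016DenseClusters, proof of Prop. 9.4 pp. 25–26] -/
theorem abs_couplingB_le (N₁ W₁ : κ → ℕ) (r : Option κ → ℕ) (g : κ → ℕ) (g₀ : ℕ) :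
    |couplingB N₁ W₁ r g g₀| ≤
      ((gBox N₁ W₁).filter (fun f => (∀ i, r (some i) ∣ f i) ∧ ∀ i, f i ∣ g i)).card *
        (g₀.divisors.filter (fun f₀ => r none ∣ f₀)).card := by
  unfold couplingB
  have h1 : ∀ (a b : ℕ), |(if (a).Coprime b then ((μ a : ℤ) : ℝ) * ((μ b : ℤ) : ℝ) else 0)| ≤ 1 := by
    intro a b
    have ha : |((μ a : ℤ) : ℝ)| ≤ 1 := by exact_mod_cast ArithmeticFunction.abs_moebius_le_one
    have hb : |((μ b : ℤ) : ℝ)| ≤ 1 := by exact_mod_cast ArithmeticFunction.abs_moebius_le_one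
    split_ifs
    · rw [abs_mul]; nlinarith [abs_nonneg ((μ a : ℤ) : ℝ), abs_nonneg ((μ b : ℤ) : ℝ)]
    · simp
  refine (Finset.abs_sum_le_sum_abs _ _).trans ?_
  refine (Finset.sum_le_sum fun f _ => (Finset.abs_sum_le_sum_abs _ _).trans
    (Finset.sum_le_sum fun f₀ _ => h1 (∏ i, f i) f₀)).trans ?_
  simp only [Finset.sum_const, nsmul_eq_mul, mul_one]
  rfl

end Literature.NumberTheory.Sieve.SelbergBox
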